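import Literature.MathematicalPhysics.KineticTheory.VelocityAveraging
import Mathlib.Analysis.Calculus.BumpFunction.FiniteDimension
import Mathlib.Analysis.Calculus.LineDeriv.Basic
import Mathlib.Analysis.SpecialFunctions.Trigonometric.Deriv
import Mathlib.Analysis.Distribution.AEEqOfIntegralContDiff
import Mathlib.Analysis.Fourier.FourierTransform
import Mathlib.Analysis.InnerProductSpace.Calculus
import HarnessLib

/-!
# Plane waves against the free transport equation

Topic: MathematicalPhysics / KineticTheory. Third proof file of the `L²` velocity averaging
lemma `Literature.MathematicalPhysics.KineticTheory.velocityAveraging_L2` (Cercignani–Illner–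
Pulvirenti 1994, Lemma 5.3.8; Golse–Lions–Perthame–Sentis 1988): the kinetic input of the
proof, i.e. the passage from the distributional equation `(∂ₜ + ξ·∇ₓ) u = h` on `ℝ × E × E`
(`HasDistribTransportOn univ u h`) to the Fourier side (CIP 1994, p. 153: "by assumption `û`
and `(τ + z·ξ) û` are in `L²`").

* `ae_eq_zero_of_hasDistribTransportOn`: if `u` vanishes off a compact set `K`, then so does
  `h = Tu` (a.e.).
* `integral_mul_transportDeriv_eq_of_contDiff`: the identity `∫ u · Tg = -∫ h · g` extends from
  compactly supported to *all* smooth `g` (localise with a bump `≡ 1` near `K`).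
* `transportDeriv_mul_cos`, `transportDeriv_mul_sin`: `T(ψ(ξ) cos(2π(tτ + ⟪x,k⟫))) =
  -2π(τ + ⟪ξ,k⟫) ψ(ξ) sin(2π(tτ + ⟪x,k⟫))` and its companion.
* `integral_planeWave_transport_eq_zero`: for every test function `ψ(ξ)` and frequency
  `(τ, k)`, `∫ ψ(ξ) e^{-2πi(tτ + ⟪x,k⟫)} (h - 2πi(τ + ⟪ξ,k⟫) u) d(t,x,ξ) = 0` — the weak form of
  `𝓕(Tu) = 2πi(τ + ⟪ξ,k⟫) 𝓕u`, obtained from the real and imaginary parts (cosine and sine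
  test functions).

## References

* C. Cercignani, R. Illner, M. Pulvirenti, *The Mathematical Theory of Dilute Gases* (1994),
  §5.3, Lemma 5.3.8 and its proof, p. 153.
* F. Golse, P.-L. Lions, B. Perthame, R. Sentis, J. Funct. Anal. 76 (1988) 110–125.
-/

noncomputable section

open MeasureTheory Real Set Filter Topology Function Complex FourierTransform Metric
open scoped FourierTransform InnerProductSpace ENNReal ContDiff

namespace Literature.MathematicalPhysics.KineticTheory

variable {E : Type*} [NormedAddCommGroup E] [InnerProductSpace ℝ E] [FiniteDimensional ℝ E]
  [MeasurableSpace E] [BorelSpace E]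

/-! ### Support of `Tu` and localisation of test functions -/

omit [FiniteDimensional ℝ E] [MeasurableSpace E] [BorelSpace E] in
/-- `Tφ` vanishes off the topological support of `φ`. [folklore] -/
theorem transportDeriv_eq_zero_of_notMem_tsupport {φ : ℝ × E × E → ℝ} {z : ℝ × E × E}
    (hz : z ∉ tsupport φ) : transportDeriv φ z = 0 := by
  rw [transportDeriv, (notMem_tsupport_iff_eventuallyEq.1 hz).fderiv_eq]
  simp

/-- **`Tu` is supported where `u` is.** If `u` vanishes off the compact set `K` and
`Tu = h ∈ L¹_loc` in `𝒟'`, then `h = 0` a.e. off `K` (test against functions supported in the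
open set `Kᶜ`). [folklore] -/
theorem ae_eq_zero_of_hasDistribTransportOn {K : Set (ℝ × E × E)} (hK : IsCompact K)
    {u h : ℝ × E × E → ℝ} (hh : LocallyIntegrable h volume) (huK : ∀ z ∉ K, u z = 0)
    (hT : HasDistribTransportOn univ u h) : ∀ᵐ z ∂volume, z ∉ K → h z = 0 := by
  have hopen : IsOpen Kᶜ := hK.isClosed.isOpen_compl
  have key := hopen.ae_eq_zero_of_integral_contDiff_smul_eq_zero (hh.locallyIntegrableOn _)
    fun g hg hgc hgK => ?_
  · simpa only [mem_compl_iff] using key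
  have h1 := hT.2.2 g hg hgc (by simp)
  have h2 : ∀ z, u z * transportDeriv g z = 0 := fun z => by
    by_cases hz : z ∈ K
    · rw [transportDeriv_eq_zero_of_notMem_tsupport (fun h' => hgK h' hz), mul_zero]
    · rw [huK z hz, zero_mul]
  simp only [h2, integral_zero, zero_eq_neg] at h1
  simpa only [smul_eq_mul, mul_comm (g _)] using h1

/-- **Localisation.** If `u` vanishes off a compact `K`, `h = 0` a.e. off `K`, and `Tu = h` in
`𝒟'`, then `∫ u · Tg = -∫ h · g` for *every* smooth `g` (not necessarily compactly supported):
replace `g` by `χ g` with a smooth bump `χ ≡ 1` near `K`. [folklore] -/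
theorem integral_mul_transportDeriv_eq_of_contDiff {K : Set (ℝ × E × E)} (hK : IsCompact K)
    {u h : ℝ × E × E → ℝ} (huK : ∀ z ∉ K, u z = 0) (hhK : ∀ᵐ z ∂volume, z ∉ K → h z = 0)
    (hT : HasDistribTransportOn univ u h) {g : ℝ × E × E → ℝ} (hg : ContDiff ℝ ∞ g) :
    ∫ z, u z * transportDeriv g z = -∫ z, h z * g z := by
  obtain ⟨R₀, hR₀, hKR₀⟩ : ∃ R₀, 0 < R₀ ∧ K ⊆ ball (0 : ℝ × E × E) R₀ :=
    hK.isBounded.subset_ball_lt 0 0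
  let χ : ContDiffBump (0 : ℝ × E × E) := ⟨R₀, R₀ + 1, hR₀, by linarith⟩
  have hφs : ContDiff ℝ ∞ fun z => χ z * g z := χ.contDiff.mul hg
  have hφc : HasCompactSupport fun z => χ z * g z := χ.hasCompactSupport.mul_right
  have h1 := hT.2.2 _ hφs hφc (by simp)
  have hL : ∀ z, u z * transportDeriv (fun z => χ z * g z) z = u z * transportDeriv g z := by
    intro z
    by_cases hz : z ∈ K
    · have hnear : (fun z => χ z * g z) =ᶠ[𝓝 z] g := by
        filter_upwards [χ.eventuallyEq_one_of_mem_ball (hKR₀ hz)] with y hy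
        rw [hy, Pi.one_apply, one_mul]
      rw [transportDeriv, transportDeriv, hnear.fderiv_eq]
    · rw [huK z hz, zero_mul, zero_mul]
  have hR : (fun z => h z * (χ z * g z)) =ᵐ[volume] fun z => h z * g z := by
    filter_upwards [hhK] with z hz
    by_cases hzK : z ∈ K
    · rw [χ.one_of_mem_closedBall (ball_subset_closedBall (hKR₀ hzK)), one_mul]
    · rw [hz hzK, zero_mul, zero_mul]
  calc ∫ z, u z * transportDeriv g z = ∫ z, u z * transportDeriv (fun z => χ z * g z) z :=
        integral_congr_ae (ae_of_all _ fun z => (hL z).symm)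
    _ = -∫ z, h z * (χ z * g z) := h1
    _ = -∫ z, h z * g z := by rw [integral_congr_ae hR]

/-! ### Plane waves -/

omit [FiniteDimensional ℝ E] [MeasurableSpace E] [BorelSpace E] in
/-- `T(ψ(ξ) cos(2π(tτ + ⟪x,k⟫))) = -2π(τ + ⟪ξ,k⟫) sin(2π(tτ + ⟪x,k⟫)) ψ(ξ)`: along the
characteristic `s ↦ (t+s, x+sξ, ξ)` the phase is `2π(tτ + ⟪x,k⟫) + 2π(τ + ⟪ξ,k⟫)s`. [folklore] -/
theorem transportDeriv_mul_cos {ψ : E → ℝ} (hψ : Differentiable ℝ ψ) (τ : ℝ) (k : E)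
    (z : ℝ × E × E) :
    transportDeriv (fun z : ℝ × E × E => ψ z.2.2 * Real.cos (2 * π * (z.1 * τ + ⟪z.2.1, k⟫_ℝ))) z =
      -(2 * π * (τ + ⟪z.2.2, k⟫_ℝ)) * Real.sin (2 * π * (z.1 * τ + ⟪z.2.1, k⟫_ℝ)) * ψ z.2.2 := by
  have hd : DifferentiableAt ℝ
      (fun z : ℝ × E × E => ψ z.2.2 * Real.cos (2 * π * (z.1 * τ + ⟪z.2.1, k⟫_ℝ))) z := by
    have h1 : DifferentiableAt ℝ (fun z : ℝ × E × E => ψ z.2.2) z :=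
      (hψ _).comp z (differentiableAt_snd.comp z differentiableAt_snd)
    have hin : Differentiable ℝ fun z : ℝ × E × E => ⟪z.2.1, k⟫_ℝ :=
      (differentiable_fst.comp differentiable_snd).inner ℝ (differentiable_const k)
    have h2 : DifferentiableAt ℝ
        (fun z : ℝ × E × E => Real.cos (2 * π * (z.1 * τ + ⟪z.2.1, k⟫_ℝ))) z :=
      (((differentiableAt_fst.mul_const τ).add (hin z)).const_mul (2 * π)).cos
    exact h1.mul h2
  set α : ℝ := 2 * π * (z.1 * τ + ⟪z.2.1, k⟫_ℝ) with hα
  set β : ℝ := 2 * π * (τ + ⟪z.2.2, k⟫_ℝ) with hβ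
  have hder : HasDerivAt (fun s : ℝ => ψ z.2.2 * Real.cos (α + β * s))
      (ψ z.2.2 * (-Real.sin (α + β * 0) * β)) 0 := by
    have h1 : HasDerivAt (fun s : ℝ => α + β * s) β 0 := by
      simpa using ((hasDerivAt_id (0 : ℝ)).const_mul β).const_add α
    exact h1.cos.const_mul _
  have hline : HasLineDerivAt ℝ
      (fun z : ℝ × E × E => ψ z.2.2 * Real.cos (2 * π * (z.1 * τ + ⟪z.2.1, k⟫_ℝ)))
      (ψ z.2.2 * (-Real.sin (α + β * 0) * β)) z ((1 : ℝ), z.2.2, (0 : E)) := by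
    unfold HasLineDerivAt
    have hfun : (fun s : ℝ => (fun z : ℝ × E × E =>
        ψ z.2.2 * Real.cos (2 * π * (z.1 * τ + ⟪z.2.1, k⟫_ℝ))) (z + s • ((1 : ℝ), z.2.2, (0 : E)))) =
        fun s => ψ z.2.2 * Real.cos (α + β * s) := by
      funext s
      simp only [Prod.snd_add, Prod.fst_add, Prod.smul_mk, smul_zero, add_zero, smul_eq_mul,
        mul_one, inner_add_left, real_inner_smul_left, hα, hβ]
      congr 2
      ring
    rw [hfun]
    exact hder
  rw [transportDeriv, ← hd.lineDeriv_eq_fderiv, hline.lineDeriv, mul_zero, add_zero]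
  ring

omit [FiniteDimensional ℝ E] [MeasurableSpace E] [BorelSpace E] in
/-- `T(ψ(ξ) sin(2π(tτ + ⟪x,k⟫))) = 2π(τ + ⟪ξ,k⟫) cos(2π(tτ + ⟪x,k⟫)) ψ(ξ)`. [folklore] -/
theorem transportDeriv_mul_sin {ψ : E → ℝ} (hψ : Differentiable ℝ ψ) (τ : ℝ) (k : E)
    (z : ℝ × E × E) :
    transportDeriv (fun z : ℝ × E × E => ψ z.2.2 * Real.sin (2 * π * (z.1 * τ + ⟪z.2.1, k⟫_ℝ))) z =
      2 * π * (τ + ⟪z.2.2, k⟫_ℝ) * Real.cos (2 * π * (z.1 * τ + ⟪z.2.1, k⟫_ℝ)) * ψ z.2.2 := by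
  have hd : DifferentiableAt ℝ
      (fun z : ℝ × E × E => ψ z.2.2 * Real.sin (2 * π * (z.1 * τ + ⟪z.2.1, k⟫_ℝ))) z := by
    have h1 : DifferentiableAt ℝ (fun z : ℝ × E × E => ψ z.2.2) z :=
      (hψ _).comp z (differentiableAt_snd.comp z differentiableAt_snd)
    have hin : Differentiable ℝ fun z : ℝ × E × E => ⟪z.2.1, k⟫_ℝ :=
      (differentiable_fst.comp differentiable_snd).inner ℝ (differentiable_const k)
    have h2 : DifferentiableAt ℝ
        (fun z : ℝ × E × E => Real.sin (2 * π * (z.1 * τ + ⟪z.2.1, k⟫_ℝ))) z :=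
      (((differentiableAt_fst.mul_const τ).add (hin z)).const_mul (2 * π)).sin
    exact h1.mul h2
  set α : ℝ := 2 * π * (z.1 * τ + ⟪z.2.1, k⟫_ℝ) with hα
  set β : ℝ := 2 * π * (τ + ⟪z.2.2, k⟫_ℝ) with hβ
  have hder : HasDerivAt (fun s : ℝ => ψ z.2.2 * Real.sin (α + β * s))
      (ψ z.2.2 * (Real.cos (α + β * 0) * β)) 0 := by
    have h1 : HasDerivAt (fun s : ℝ => α + β * s) β 0 := by
      simpa using ((hasDerivAt_id (0 : ℝ)).const_mul β).const_add α
    exact h1.sin.const_mul _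
  have hline : HasLineDerivAt ℝ
      (fun z : ℝ × E × E => ψ z.2.2 * Real.sin (2 * π * (z.1 * τ + ⟪z.2.1, k⟫_ℝ)))
      (ψ z.2.2 * (Real.cos (α + β * 0) * β)) z ((1 : ℝ), z.2.2, (0 : E)) := by
    unfold HasLineDerivAt
    have hfun : (fun s : ℝ => (fun z : ℝ × E × E =>
        ψ z.2.2 * Real.sin (2 * π * (z.1 * τ + ⟪z.2.1, k⟫_ℝ))) (z + s • ((1 : ℝ), z.2.2, (0 : E)))) =
        fun s => ψ z.2.2 * Real.sin (α + β * s) := by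
      funext s
      simp only [Prod.snd_add, Prod.fst_add, Prod.smul_mk, smul_zero, add_zero, smul_eq_mul,
        mul_one, inner_add_left, real_inner_smul_left, hα, hβ]
      congr 2
      ring
    rw [hfun]
    exact hder
  rw [transportDeriv, ← hd.lineDeriv_eq_fderiv, hline.lineDeriv, mul_zero, add_zero]
  ring

/-! ### The weak Fourier identity -/

/-- The Fourier character in real and imaginary parts:
`e^{-2πi s} = cos(2πs) - i sin(2πs)`. [folklore] -/
theorem fourierChar_neg_eq_cos_sub_sin (s : ℝ) :
    ((𝐞 (-s) : Circle) : ℂ) = (Real.cos (2 * π * s) : ℂ) - (Real.sin (2 * π * s) : ℂ) * Complex.I := by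
  rw [Real.fourierChar_apply, Complex.exp_mul_I, ← Complex.ofReal_cos, ← Complex.ofReal_sin,
    mul_neg, Real.cos_neg, Real.sin_neg, Complex.ofReal_neg, neg_mul, sub_eq_add_neg]

/-- Bound for the plane-wave multipliers: `‖2π a s p‖ ≤ 2π C` if `|s| ≤ 1`, `|p a| ≤ C`. [folklore] -/
theorem norm_two_pi_mul_le {a s p C : ℝ} (hs : |s| ≤ 1) (hp : |p * a| ≤ C) :
    ‖2 * π * a * s * p‖ ≤ 2 * π * C := by
  rw [Real.norm_eq_abs, show 2 * π * a * s * p = (2 * π) * (s * (p * a)) by ring, abs_mul,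
    abs_of_pos Real.two_pi_pos, abs_mul]
  have h := mul_le_mul hs hp (abs_nonneg _) zero_le_one
  rw [one_mul] at h
  exact mul_le_mul_of_nonneg_left h Real.two_pi_pos.le

/-- **Weak form of `𝓕(Tu) = 2πi(τ + ⟪ξ,k⟫) 𝓕u`** (CIP 1994, proof of Lemma 5.3.8, p. 153:
"`û` and `(τ + z·ξ)û` are in `L²`"). Let `u, h ∈ L¹(ℝ × E × E)`, `u = 0` off a compact `K`,
`h = 0` a.e. off `K`, and `Tu = h` in `𝒟'`. Then for every test function `ψ(ξ)` and every
frequency `(τ, k)`,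
`∫ ψ(ξ) e^{-2πi(tτ + ⟪x,k⟫)} (h - 2πi(τ + ⟪ξ,k⟫) u)(t,x,ξ) d(t,x,ξ) = 0`
(test the transport equation with `ψ(ξ)cos(2π(tτ + ⟪x,k⟫))` and `ψ(ξ)sin(2π(tτ + ⟪x,k⟫))`
and combine). [cite: CIP1994, §5.3 Lemma 5.3.8 (proof)] -/
theorem integral_planeWave_transport_eq_zero {K : Set (ℝ × E × E)} (hK : IsCompact K)
    {u h : ℝ × E × E → ℝ} (hu : Integrable u volume) (hh : Integrable h volume)
    (huK : ∀ z ∉ K, u z = 0) (hhK : ∀ᵐ z ∂volume, z ∉ K → h z = 0)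
    (hT : HasDistribTransportOn univ u h) {ψ : E → ℝ} (hψ : ContDiff ℝ ∞ ψ)
    (hψc : HasCompactSupport ψ) (τ : ℝ) (k : E) :
    ∫ z, (ψ z.2.2 : ℂ) * ((((𝐞 (-(z.1 * τ + ⟪z.2.1, k⟫_ℝ))) : Circle) : ℂ) *
      ((h z : ℂ) - 2 * π * Complex.I * (τ + ⟪z.2.2, k⟫_ℝ) * (u z : ℂ))) = 0 := by
  have hψd : Differentiable ℝ ψ := hψ.differentiable (by simp)
  -- the two real identities
  have hgc : ContDiff ℝ ∞ fun z : ℝ × E × E =>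
      ψ z.2.2 * Real.cos (2 * π * (z.1 * τ + ⟪z.2.1, k⟫_ℝ)) := by
    refine (hψ.comp (contDiff_snd.comp contDiff_snd)).mul (Real.contDiff_cos.comp ?_)
    exact contDiff_const.mul ((contDiff_fst.mul contDiff_const).add
      ((contDiff_fst.comp contDiff_snd).inner ℝ contDiff_const))
  have hgs : ContDiff ℝ ∞ fun z : ℝ × E × E =>
      ψ z.2.2 * Real.sin (2 * π * (z.1 * τ + ⟪z.2.1, k⟫_ℝ)) := by
    refine (hψ.comp (contDiff_snd.comp contDiff_snd)).mul (Real.contDiff_sin.comp ?_)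
    exact contDiff_const.mul ((contDiff_fst.mul contDiff_const).add
      ((contDiff_fst.comp contDiff_snd).inner ℝ contDiff_const))
  have hEc : ∫ z, u z * (-(2 * π * (τ + ⟪z.2.2, k⟫_ℝ)) *
      Real.sin (2 * π * (z.1 * τ + ⟪z.2.1, k⟫_ℝ)) * ψ z.2.2) =
      -∫ z, h z * (ψ z.2.2 * Real.cos (2 * π * (z.1 * τ + ⟪z.2.1, k⟫_ℝ))) := by
    rw [← integral_mul_transportDeriv_eq_of_contDiff hK huK hhK hT hgc]
    refine integral_congr_ae (ae_of_all _ fun z => ?_)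
    simp only
    rw [transportDeriv_mul_cos hψd τ k z]
  have hEs : ∫ z, u z * (2 * π * (τ + ⟪z.2.2, k⟫_ℝ) *
      Real.cos (2 * π * (z.1 * τ + ⟪z.2.1, k⟫_ℝ)) * ψ z.2.2) =
      -∫ z, h z * (ψ z.2.2 * Real.sin (2 * π * (z.1 * τ + ⟪z.2.1, k⟫_ℝ))) := by
    rw [← integral_mul_transportDeriv_eq_of_contDiff hK huK hhK hT hgs]
    refine integral_congr_ae (ae_of_all _ fun z => ?_)
    simp only
    rw [transportDeriv_mul_sin hψd τ k z]
  -- integrability of the four real integrands (bounded continuous multipliers)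
  have hcos1 : ∀ x : ℝ, ‖Real.cos x‖ ≤ 1 := fun x => by
    rw [Real.norm_eq_abs]; exact Real.abs_cos_le_one x
  have hsin1 : ∀ x : ℝ, ‖Real.sin x‖ ≤ 1 := fun x => by
    rw [Real.norm_eq_abs]; exact Real.abs_sin_le_one x
  obtain ⟨Cψ, hCψ⟩ := hψ.continuous.bounded_above_of_compact_support hψc
  have hψa_c : Continuous fun ξ : E => ψ ξ * (τ + ⟪ξ, k⟫_ℝ) := by fun_prop
  have hψa_s : HasCompactSupport fun ξ : E => ψ ξ * (τ + ⟪ξ, k⟫_ℝ) := hψc.mul_right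
  obtain ⟨Ca, hCa⟩ := hψa_c.bounded_above_of_compact_support hψa_s
  have hCa' : ∀ ξ, |ψ ξ * (τ + ⟪ξ, k⟫_ℝ)| ≤ Ca := fun ξ => by
    simpa only [Real.norm_eq_abs] using hCa ξ
  have hIc : Integrable (fun z : ℝ × E × E =>
      h z * (ψ z.2.2 * Real.cos (2 * π * (z.1 * τ + ⟪z.2.1, k⟫_ℝ)))) volume := by
    refine hh.mul_bdd (c := Cψ) (Continuous.aestronglyMeasurable (by fun_prop))
      (ae_of_all _ fun z => ?_)
    rw [norm_mul]
    exact (mul_le_of_le_one_right (norm_nonneg _) (hcos1 _)).trans (hCψ _)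
  have hIs : Integrable (fun z : ℝ × E × E =>
      h z * (ψ z.2.2 * Real.sin (2 * π * (z.1 * τ + ⟪z.2.1, k⟫_ℝ)))) volume := by
    refine hh.mul_bdd (c := Cψ) (Continuous.aestronglyMeasurable (by fun_prop))
      (ae_of_all _ fun z => ?_)
    rw [norm_mul]
    exact (mul_le_of_le_one_right (norm_nonneg _) (hsin1 _)).trans (hCψ _)
  have hJc : Integrable (fun z : ℝ × E × E => u z * (-(2 * π * (τ + ⟪z.2.2, k⟫_ℝ)) *
      Real.sin (2 * π * (z.1 * τ + ⟪z.2.1, k⟫_ℝ)) * ψ z.2.2)) volume := by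
    refine hu.mul_bdd (c := 2 * π * Ca) (Continuous.aestronglyMeasurable (by fun_prop))
      (ae_of_all _ fun z => ?_)
    rw [neg_mul, neg_mul, norm_neg]
    exact norm_two_pi_mul_le (Real.abs_sin_le_one _) (hCa' z.2.2)
  have hJs : Integrable (fun z : ℝ × E × E => u z * (2 * π * (τ + ⟪z.2.2, k⟫_ℝ) *
      Real.cos (2 * π * (z.1 * τ + ⟪z.2.1, k⟫_ℝ)) * ψ z.2.2)) volume := by
    refine hu.mul_bdd (c := 2 * π * Ca) (Continuous.aestronglyMeasurable (by fun_prop))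
      (ae_of_all _ fun z => ?_)
    exact norm_two_pi_mul_le (Real.abs_cos_le_one _) (hCa' z.2.2)
  -- real and imaginary parts of the complex integrand
  have hA : ∫ z, (h z * (ψ z.2.2 * Real.cos (2 * π * (z.1 * τ + ⟪z.2.1, k⟫_ℝ))) +
      u z * (-(2 * π * (τ + ⟪z.2.2, k⟫_ℝ)) *
        Real.sin (2 * π * (z.1 * τ + ⟪z.2.1, k⟫_ℝ)) * ψ z.2.2)) = 0 := by
    rw [integral_add hIc hJc, hEc, add_neg_cancel]
  have hB : ∫ z, (h z * (ψ z.2.2 * Real.sin (2 * π * (z.1 * τ + ⟪z.2.1, k⟫_ℝ))) +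
      u z * (2 * π * (τ + ⟪z.2.2, k⟫_ℝ) *
        Real.cos (2 * π * (z.1 * τ + ⟪z.2.1, k⟫_ℝ)) * ψ z.2.2)) = 0 := by
    rw [integral_add hIs hJs, hEs, add_neg_cancel]
  have hpt : ∀ z : ℝ × E × E, (ψ z.2.2 : ℂ) * ((((𝐞 (-(z.1 * τ + ⟪z.2.1, k⟫_ℝ))) : Circle) : ℂ) *
      ((h z : ℂ) - 2 * π * Complex.I * (τ + ⟪z.2.2, k⟫_ℝ) * (u z : ℂ))) =
      ((h z * (ψ z.2.2 * Real.cos (2 * π * (z.1 * τ + ⟪z.2.1, k⟫_ℝ))) +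
        u z * (-(2 * π * (τ + ⟪z.2.2, k⟫_ℝ)) *
          Real.sin (2 * π * (z.1 * τ + ⟪z.2.1, k⟫_ℝ)) * ψ z.2.2) : ℝ) : ℂ) -
      ((h z * (ψ z.2.2 * Real.sin (2 * π * (z.1 * τ + ⟪z.2.1, k⟫_ℝ))) +
        u z * (2 * π * (τ + ⟪z.2.2, k⟫_ℝ) *
          Real.cos (2 * π * (z.1 * τ + ⟪z.2.1, k⟫_ℝ)) * ψ z.2.2) : ℝ) : ℂ) * Complex.I := by
    intro z
    rw [fourierChar_neg_eq_cos_sub_sin]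
    linear_combination (norm := (push_cast; ring))
      ((2 * π * (τ + ⟪z.2.2, k⟫_ℝ) * u z * Real.sin (2 * π * (z.1 * τ + ⟪z.2.1, k⟫_ℝ)) *
        ψ z.2.2 : ℝ) : ℂ) * Complex.I_sq
  simp_rw [hpt]
  rw [integral_sub ((hIc.add hJc).ofReal) ((hIs.add hJs).ofReal.mul_const _),
    integral_mul_const, integral_complex_ofReal, integral_complex_ofReal, hA, hB]
  simp

end Literature.MathematicalPhysics.KineticTheory
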